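import Summits.CriticalPhenomena.PercolationContinuityZ3.Theorems.Transplant.Bcc111SKPath
import Summits.CriticalPhenomena.PercolationContinuityZ3.Theorems.Transplant.HexShadowVRouteDataX
import HarnessLib

/-!
# The bcc (111)-films at small thickness, V: CERTIFIED TERMINALS (exit form) PASS THE BITBOARD FILTER

builds on p205010 (kernel theorem, internal audit signed; external expert review pending) — NOT used in this file.  Lane `prim-bschramm`, seat
`prim-bschramm-p2` (gen 49; class C1b; memo `HOME/bschramm/P2-LATTICES.md` §160); helper file (`--supports stmt-CriticalPhenomena-4575 --as helper`).
The twin of «Slab111SKTerms» for the EXIT-FORM terminals of «HexShadowVRouteDataX» on the bcc (111)-film: if `(E₁, E₂, w')` is certified by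
`(Bcc111.hexShadow m).TerminalsX 3 z t_R t_D s_R s_D (Wset C z)` and the case context `C` dominates the node parameters (`C.tR = min t_R 3`, `C.sR = min s_R 3`,
window bounds at least `t_D`, `s_R`, `s_D` or unconstrained, cleared mask over `hexBall z 3`), then `E₁, E₂, w'` are index vertices, `E₁, E₂` are listed
terminals, and the bit of `w'` is set in the exit-form need mask `C.needMask e₁ e₂` («Bcc111SKDefs»: the `Terminals` mirror AND the exit mask `exitM`).
* §1 neighbour lists (`mem_nbrList`, `mem_outs`, `mem_ins`, `mem_esList`);  §2 **`terminalsX_sound`**.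
[cite: DuminilCopinSidoraviciusTassion2016, §2.3 (proof of Fact 2: u', v', w' and the path π)]
-/

noncomputable section

namespace Summit.CriticalPhenomena.PercolationContinuityZ3.Theorems.Transplant

open Literature.Probability.Percolation Literature.Probability.LatticeModels SimpleGraph
open scoped Classical

namespace Bcc111.SK

open Slab111.SK (dL dA dB bitOf sdiff lowStep lowIdx maskOfList endsOK maskBelow orFold rd rdMask colSlots testBit_bitOf testBit_sdiff
  testBit_maskBelow of_testBit_maskBelow testBit_maskBelow_of testBit_foldl_or testBit_orFold testBit_maskOfList testBit_maskOfList_eq_false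
  testBit_of_sdiff_eq_zero testBit_of_sdiff_beq testBit_false_of_land_eq_zero endsOK_sound)

variable {C : CtxE} {z : Site 2}

/-! ## §1 Neighbour lists -/

/-- An `AdjRelE`-neighbour in the universe is listed by `nbrList`. [folklore] -/
theorem mem_nbrList {e j : ℕ} (hj : C.validB j = true) (h : AdjRelE e j) : j ∈ C.nbrList e := by
  unfold CtxE.nbrList
  rw [List.mem_filter]
  refine ⟨?_, by rw [adjE_iff.2 h, (testBit_univ_iff C j).2 hj]; rfl⟩
  unfold AdjRelE at h
  simp only [List.mem_cons, List.not_mem_nil, or_false]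
  omega

/-- Members of `nbrList` are valid `AdjRelE`-neighbours. [folklore] -/
theorem of_mem_nbrList {e j : ℕ} (h : j ∈ C.nbrList e) : C.validB j = true ∧ AdjRelE e j := by
  unfold CtxE.nbrList at h
  rw [List.mem_filter, Bool.and_eq_true] at h
  exact ⟨(testBit_univ_iff C j).1 h.2.2, adjE_iff.1 h.2.1⟩

/-- An outside window neighbour is listed by `outs`. [folklore] -/
theorem mem_outs {e j : ℕ} (hj : C.validB j = true) (h : AdjRelE e j) (hwin : C.inWinB j = true) (hW : C.W.testBit j = false) : j ∈ C.outs e := by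
  unfold CtxE.outs
  rw [List.mem_filter]
  exact ⟨mem_nbrList hj h, by rw [(testBit_win_iff C j).2 hwin, hW]; rfl⟩

/-- A window neighbour is listed by `ins`. [folklore] -/
theorem mem_ins {e j : ℕ} (hj : C.validB j = true) (h : AdjRelE e j) (hwin : C.inWinB j = true) : j ∈ C.ins e := by
  unfold CtxE.ins
  rw [List.mem_filter]
  exact ⟨mem_nbrList hj h, (testBit_win_iff C j).2 hwin⟩

/-- Membership in the terminal list. [folklore] -/
theorem mem_esList {C : CtxE} {e : ℕ} (hv : C.validB e = true) (hWR : C.WR.testBit e = true) (hcen : C.cen.testBit e = false) {j : ℕ} (hj : j ∈ C.outs e) :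
    e ∈ C.esList := by
  unfold CtxE.esList
  rw [List.mem_filter, List.mem_range]
  refine ⟨((validB_iff C e).1 hv).1, ?_⟩
  rw [hWR, hcen]
  have : (C.outs e).isEmpty = false := by
    cases h : C.outs e with
    | nil => rw [h] at hj; simp at hj
    | cons _ _ => rfl
  rw [this]; rfl

/-- Boolean inequality from distinct index vertices. [folklore] -/
theorem bne_of_ivtx_ne {i j : ℕ} (h : ivtx C.k z i ≠ ivtx C.k z j) : (i != j) = true := by
  rw [bne_iff_ne]; rintro rfl; exact h rfl

/-! ## §2 Certified terminals pass the filter -/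

/-- **EXIT-FORM CERTIFIED TERMINALS PASS THE BITBOARD FILTER.**  [cite: DuminilCopinSidoraviciusTassion2016, §2.3 (proof of Fact 2: u', v', w' and π)] -/
theorem terminalsX_sound (hz : ClassHyp C z) (hk : C.k ≤ 9) {tR tD sR sD : ℕ} (htR : C.tR = min tR 3) (hsR : C.sR = min sR 3)
    (hwT : tD ≤ C.wT ∨ 4 ≤ C.wT) (hwS : sR ≤ C.wS ∨ 4 ≤ C.wS) (hwSD : sD ≤ C.wSD ∨ 4 ≤ C.wSD)
    (hW3 : ∀ i, C.validB i = true → C.W.testBit i = true → triNorm (sh (ivtx C.k z i) - z) ≤ 3) {E₁ E₂ w' : bfilm C.k}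
    (hT : (hexShadow C.k).TerminalsX 3 z tR tD sR sD (Wset C z) E₁ E₂ w') :
    ∃ e1 e2 w, C.validB e1 = true ∧ C.validB e2 = true ∧ C.validB w = true ∧ ivtx C.k z e1 = E₁ ∧ ivtx C.k z e2 = E₂ ∧ ivtx C.k z w = w' ∧
      C.WR.testBit e1 = true ∧ C.WR.testBit e2 = true ∧ C.W.testBit w = true ∧
      e1 ∈ C.esList ∧ e2 ∈ C.esList ∧ e1 ≠ e2 ∧ (C.needMask e1 e2).testBit w = true := by
  obtain ⟨e1, hv1, hW1, rfl⟩ := exists_idx_of_mem_Wset hT.E₁W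
  obtain ⟨e2, hv2, hW2, rfl⟩ := exists_idx_of_mem_Wset hT.E₂W
  obtain ⟨w, hvw, hWw, rfl⟩ := exists_idx_of_mem_Wset hT.w'W
  have hne : e1 ≠ e2 := fun h => hT.ne (by rw [h])
  -- rerouting block and centre
  have hR1 : C.inRB e1 = true := (inRB_iff_mem_blkR hz hv1 htR hsR).2 (by simpa using hT.E₁R)
  have hR2 : C.inRB e2 = true := (inRB_iff_mem_blkR hz hv2 htR hsR).2 (by simpa using hT.E₂R)
  have hWR1 : C.WR.testBit e1 = true := (testBit_WR_iff C e1).2 ⟨hW1, hR1⟩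
  have hWR2 : C.WR.testBit e2 = true := (testBit_WR_iff C e2).2 ⟨hW2, hR2⟩
  have h31 := triNorm_le_three_of_inRB hz hR1
  have h32 := triNorm_le_three_of_inRB hz hR2
  have h3w := hW3 w hvw hWw
  have cenFalse : ∀ {i : ℕ}, C.validB i = true → sh (ivtx C.k z i) ≠ z → C.cen.testBit i = false := by
    intro i hv hne'
    rw [Bool.eq_false_iff]
    intro h
    exact hne' ((cenB_iff hz hv).1 ((testBit_cen_iff C i).1 h))
  have hc1 : C.cen.testBit e1 = false := cenFalse hv1 (by simpa using hT.E₁z)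
  have hc2 : C.cen.testBit e2 = false := cenFalse hv2 (by simpa using hT.E₂z)
  have hcw : C.cen.testBit w = false := cenFalse hvw (by simpa using hT.w'z)
  -- the four γ-neighbours
  obtain ⟨o₁, a₁, a₂, o₂, ho1, ha1, ha2, ho2, ho1W, ho2W, hwo1, hwa1, hwa2, hwo2, hn1, hn2, hn3, hn4, hn5, hn6, hn7, hn8, hc01, hca1, hca2, hco2⟩ :=
    hT.nbrs
  simp only [hexShadow_sh] at hwo1 hwa1 hwa2 hwo2 hn8 hc01 hca1 hca2 hco2
  obtain ⟨jo1, hvo1, rfl, hro1⟩ := exists_idx_of_adj hz hk hv1 h31 ho1.symm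
  obtain ⟨ja1, hva1, rfl, hra1⟩ := exists_idx_of_adj hz hk hv1 h31 ha1
  obtain ⟨ja2, hva2, rfl, hra2⟩ := exists_idx_of_adj hz hk hv2 h32 ha2.symm
  obtain ⟨jo2, hvo2, rfl, hro2⟩ := exists_idx_of_adj hz hk hv2 h32 ho2
  have hWo1 : C.W.testBit jo1 = false := by rw [Bool.eq_false_iff]; intro h; exact ho1W ((ivtx_mem_Wset_iff hz hvo1).2 h)
  have hWo2 : C.W.testBit jo2 = false := by rw [Bool.eq_false_iff]; intro h; exact ho2W ((ivtx_mem_Wset_iff hz hvo2).2 h)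
  have mo1 : jo1 ∈ C.outs e1 := mem_outs hvo1 hro1 (inWinB_of_inWin hz hvo1 hwT hwS hwo1) hWo1
  have ma1 : ja1 ∈ C.ins e1 := mem_ins hva1 hra1 (inWinB_of_inWin hz hva1 hwT hwS hwa1)
  have mo2 : jo2 ∈ C.outs e2 := mem_outs hvo2 hro2 (inWinB_of_inWin hz hvo2 hwT hwS hwo2) hWo2
  have ma2 : ja2 ∈ C.ins e2 := mem_ins hva2 hra2 (inWinB_of_inWin hz hva2 hwT hwS hwa2)
  refine ⟨e1, e2, w, hv1, hv2, hvw, rfl, rfl, rfl, hWR1, hWR2, hWw, mem_esList hv1 hWR1 hc1 mo1, mem_esList hv2 hWR2 hc2 mo2, hne, ?_⟩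
  have colFalse : ∀ {e j : ℕ}, C.validB e = true → C.validB j = true → sh (ivtx C.k z j) ≠ sh (ivtx C.k z e) → (C.colM e).testBit j = false := by
    intro e j hve hvj hne'
    rw [Bool.eq_false_iff]
    intro h
    exact hne' ((testBit_colM_iff_sh hz hve hvj).1 h)
  -- the need mask: `Terminals` part and exit part
  unfold CtxE.needMask
  rw [Nat.testBit_land, Bool.and_eq_true]
  constructor
  · unfold CtxE.needMask0
    rw [testBit_orFold]
    refine ⟨jo1, mo1, ?_⟩
    rw [testBit_orFold]
    refine ⟨ja1, ma1, ?_⟩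
    rw [testBit_orFold]
    refine ⟨jo2, mo2, ?_⟩
    rw [testBit_orFold]
    refine ⟨ja2, ma2, ?_⟩
    have hq : C.quadOK e1 e2 jo1 ja1 jo2 ja2 = true := by
      unfold CtxE.quadOK
      simp only [Bool.and_eq_true, Bool.or_eq_true]
      refine ⟨⟨⟨⟨⟨⟨⟨bne_of_ivtx_ne hn1, bne_of_ivtx_ne hn2⟩, bne_of_ivtx_ne (Ne.symm hn5)⟩, bne_of_ivtx_ne (Ne.symm hn7)⟩, bne_of_ivtx_ne hn3⟩,
        bne_of_ivtx_ne hn4⟩, bne_of_ivtx_ne (Ne.symm hn6)⟩, ?_⟩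
      by_cases h12 : ja1 = ja2
      · right
        exact (testBit_cen_iff C ja1).2 ((cenB_iff hz hva1).2 (hn8 (by rw [h12])))
      · left; exact bne_iff_ne.2 h12
    rw [hq, cond_true]
    simp only [testBit_sdiff, Nat.testBit_lor, hWw, hcw, colFalse hv1 hvw (by simpa using hT.w'E₁), colFalse hv2 hvw (by simpa using hT.w'E₂),
      colFalse hvo1 hvw hc01, colFalse hva1 hvw hca1, colFalse hva2 hvw hca2, colFalse hvo2 hvw hco2, Bool.or_false, Bool.not_false, Bool.and_true]
  · -- the exit neighbour
    obtain ⟨x, hadj, hxW, hxwin, hxz, hx1, hx2⟩ := hT.w'x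
    simp only [hexShadow_sh] at hxwin hxz hx1 hx2
    obtain ⟨jx, hvx, rfl, hrx⟩ := exists_idx_of_adj hz hk hvw h3w hadj
    have hWx : C.W.testBit jx = false := by rw [Bool.eq_false_iff]; intro h; exact hxW ((ivtx_mem_Wset_iff hz hvx).2 h)
    unfold CtxE.exitM
    refine testBit_nbhE_of ((testBit_univ_iff C w).2 hvw) ?_ hrx.symm
    simp only [testBit_sdiff, Nat.testBit_lor, hWx, cenFalse hvx hxz, colFalse hv1 hvx hx1, colFalse hv2 hvx hx2,
      (testBit_win2_iff C jx).2 (inWin2B_of_inWin hz hvx hwT hwSD hxwin), Bool.or_false, Bool.not_false, Bool.and_true]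

end Bcc111.SK

end Summit.CriticalPhenomena.PercolationContinuityZ3.Theorems.Transplant

end
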